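import Summits.QuantumFields.YangMills.Theorems.BalabanUVNodesN15CovariantLandauProjection
import HarnessLib

/-!
# Route «BalabanUVNodes», node N15 = NE2, road (c) — PROGRAMME (P-R), X: THE PERTURBATION ALGEBRA OF THE LANDAU SUMMAND — resolvent and telescoping identities expressing
# `D_U(I−R(U))D*_U − D_{U′}(I−R(U′))D*_{U′}` (in particular the Landau perturbation letter `N_V^R = landauCov(U) − landauCov(1)`) through ONE-FACTOR DIFFERENCES `D_U − D_{U′}`,
# `Q′(U) − Q′(U′)`, with the genuine inverses `G′`, `(Q′G′²Q′*)⁻¹` of n15-c∕199 (dag-n15-c g22, n15-c∕205)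

Cell `pub-ymgap`, seat `pub-ymgap-dag-n15-c` (generation g22; R134 (a), s1; HUMAN RULING D-0062; chair R424 venue).  `bears_on: R4∕N15 · K3⁸ SpineGivenEndpointR13SepCoPHV
(stmt-QuantumFields-27366)`; filed `--supports stmt-QuantumFields-27366 --as helper` — COUNT-NEUTRAL.  Finite algebra ([folklore]); no `def`; 0 `sorry`; NO estimate.  Imports BY NAME
n15-c∕199 `…N15CovariantLandauProjection` (`claplA_mul_cGreen`, `cGreen_mul_claplA`, `isUnit_cSop`; through it n15-c∕197's objects and `cgrad_mulVec`-level definitions).  Nothing in the tree modified ∕ restated.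

WHY (the lane's LOCATED next object after n15-c∕197–204: the LANDAU PERTURBATION LETTERS — near∕far∕two-grid rows of `N_V^R(U) = D_U(I−R(U))D*_U − ∂Π∂* ⊗ 1_ι` displayed in n15-c∕202–204;
[Balaban1985BackgroundPropagators] Thm 3.2 p. 398, (3.49) p. 399, Thm 3.4 p. 400 *«describing these analytic extensions as small perturbations of the operators depending on U
only»*).  Every such letter starts from the same algebra: the difference of the composite `D(I−R)D* = D·G′Q′ᵀ(Q′G′²Q′ᵀ)⁻¹Q′G′·Dᵀ` at two backgrounds is a sum of terms each carrying
EXACTLY ONE difference of a first-order object (`D_U − D_{U′}`: entries `n·(T − T′)` on the shift part only; `Q′(U) − Q′(U′)`: kernel `n^{−(d+1)}(T(Γ) − T′(Γ))`) dressed by the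
inverses, via the resolvent identities `G′ − G′′ = G′(Δ′′ − Δ′)G′′`, `S⁻¹ − S′⁻¹ = S⁻¹(S′ − S)S′⁻¹` (genuine two-sided inverses by n15-c∕199).  THIS FILE proves these identities once,
in the model, so that the sequel's estimates are bookkeeping of block majorants over them.

RESULTS ([folklore] algebra).
* §1 one-factor differences: `cgrad_sub_apply` (`(D_T − D_{T′})((x,ν),i)(y,j) = n·𝟙[y = x+e_ν]·(T − T′)_ν(x)_{ij}` — the identity part cancels), `cgrad_sub_rows_le`∕`cgrad_sub_cols_le`
  (row∕column sums `≤ n·ρ` from entry rows∕columns of `T − T′` `≤ ρ`), `csavg_sub_apply`, `csavg_sub_rows_le` (`≤ σ` from rows of the staircase-transport difference), `csavg_sub_cols_le`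
  (`≤ n^{−(d+1)}·σ`).
* §2 telescoping: `mmul3_sub`, `mmul5_sub` (rectangular matrices), ★ `claplA_sub`, ★ `cGreen_sub` (resolvent identity), `cGreen_sq_sub`, ★ `cSop_sub`, ★ `cSop_inv_sub`, ★★ `cPi_sub` (five terms),
  ★★ **`landauCov_sub`** (three terms: `(D−D′)ΠDᵀ + D′(Π−Π′)Dᵀ + D′Π′(D−D′)ᵀ`).
* §3 at the flat background: ★★ **`landauCov_sub_one`** — `landauCov T a − landauFlat a ⊗ₖ 1 = (D_T − ∂⊗1)·Π_T·D_Tᵀ + (∂⊗1)·(Π_T − Π₁⊗1)·D_Tᵀ + (∂⊗1)(Π₁⊗1)·(D_T − ∂⊗1)ᵀ` (the matrix of the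
  knit's `N_V^R`, n15-c∕201 `cvNVr`, before `mulVecLin`), `cPi_sub_one` (its middle factor in five one-difference terms).

HONEST FRAMING ∕ LIMITS.  Identities only; no estimate (no decay of `G′`, `(Q′G′²Q′*)⁻¹` is claimed — those are the flat inputs + Neumann series of the sequel); MODEL READING as
n15-c∕197.  NOT [Balaban1985BackgroundPropagators] Thms 3.1–3.4; NE2⁺ NOT PRINTED; N15 of record untouched (DISCHARGED AS CONSUMED, p687738); counts UNMOVED (typed 28∕28); one finite
𝕋⁴ at fixed ε per index — NOT infinite volume ∕ OS ∕ mass gap ∕ Clay.  Restate-immune (no Theses import).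
-/

noncomputable section

open scoped BigOperators Matrix Kronecker
open Finset

namespace Summit.QuantumFields.YangMills.BalabanUVNodes.N15.CovLandau

open Literature.MathematicalPhysics.QuantumFieldTheory.Balaban1983to89
open Literature.MathematicalPhysics.QuantumFieldTheory.Balaban1983to89.B5Prop11Plancherel (Tor fine unitVec)
open Literature.MathematicalPhysics.QuantumFieldTheory.Balaban1983to89.B5Block118 (bpt)
open Literature.MathematicalPhysics.QuantumFieldTheory.King1986.Torus (blockOf)
open Summit.QuantumFields.YangMills.BalabanUVNodes.N15.VectorPiece (blockCoords blockCoords_bpt bpt_blockCoords)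
open Summit.QuantumFields.YangMills.BalabanUVNodes.N15.DefectKernel (kingBlockOf_bpt)
open Summit.QuantumFields.YangMills.BalabanUVNodes.N15.CovAvg (cvaStair)

variable {d : ℕ} (M : Fin (d + 1) → ℕ) [∀ μ, NeZero (M μ)] (n : ℕ) [NeZero n] {ι : Type} [Fintype ι] [DecidableEq ι]

/-! ## §1 One-factor differences -/

section First

omit [∀ μ, NeZero (M μ)] [NeZero n] [Fintype ι] in
/-- THE DIFFERENCE OF TWO COVARIANT GRADIENTS LIVES ON THE SHIFT PART: `(D_T − D_{T′})((x,ν),i)(y,j) = n·𝟙[y = x + e_ν]·(T_ν(x) − T′_ν(x))_{ij}`. [folklore] -/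
theorem cgrad_sub_apply (T T' : Fin (d + 1) → Tor (fine n M) → Matrix ι ι ℝ) (p : (Tor (fine n M) × Fin (d + 1)) × ι) (q : Tor (fine n M) × ι) :
    (cgrad M n T - cgrad M n T') p q = (n : ℝ) * (if q.1 = p.1.1 + unitVec (fine n M) p.1.2 then (T p.1.2 p.1.1 - T' p.1.2 p.1.1) p.2 q.2 else 0) := by
  rw [Matrix.sub_apply]
  simp only [cgrad, Matrix.sub_apply]
  split_ifs <;> ring

/-- ROW SUMS of `D_T − D_{T′}`: `≤ n·ρ` when every entry row of `T − T′` is `≤ ρ`. [folklore] -/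
theorem cgrad_sub_rows_le {T T' : Fin (d + 1) → Tor (fine n M) → Matrix ι ι ℝ} {ρ : ℝ} (hρ : ∀ ν x i, ∑ j, |(T ν x - T' ν x) i j| ≤ ρ)
    (p : (Tor (fine n M) × Fin (d + 1)) × ι) : ∑ q, |(cgrad M n T - cgrad M n T') p q| ≤ (n : ℝ) * ρ := by
  have hn : (0 : ℝ) ≤ n := Nat.cast_nonneg n
  rw [Fintype.sum_prod_type]
  simp only [cgrad_sub_apply]
  rw [Finset.sum_eq_single (p.1.1 + unitVec (fine n M) p.1.2) (fun y _ hy => by simp [hy]) (fun h => (h (Finset.mem_univ _)).elim)]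
  simp only [if_true, abs_mul, Nat.abs_cast, ← Finset.mul_sum]
  exact mul_le_mul_of_nonneg_left (by simpa only [Matrix.sub_apply] using hρ p.1.2 p.1.1 p.2) hn

/-- COLUMN SUMS of `D_T − D_{T′}`: `≤ n·ρ` when every entry column of `T − T′` is `≤ ρ` (each fine site is the far endpoint of exactly one bond per direction: `(d+1)` directions).
[folklore] -/
theorem cgrad_sub_cols_le {T T' : Fin (d + 1) → Tor (fine n M) → Matrix ι ι ℝ} {ρ : ℝ} (hρ : ∀ ν x j, ∑ i, |(T ν x - T' ν x) i j| ≤ ρ)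
    (q : Tor (fine n M) × ι) : ∑ p, |(cgrad M n T - cgrad M n T') p q| ≤ (n : ℝ) * (Fintype.card (Fin (d + 1)) * ρ) := by
  have hn : (0 : ℝ) ≤ n := Nat.cast_nonneg n
  rw [Fintype.sum_prod_type, Fintype.sum_prod_type]
  simp only [cgrad_sub_apply, abs_mul, Nat.abs_cast]
  -- for fixed `ν` only `x = q.1 − e_ν` contributes
  have hν : ∀ ν : Fin (d + 1), ∑ x : Tor (fine n M), ∑ i : ι, (n : ℝ) * |(if q.1 = x + unitVec (fine n M) ν then (T ν x - T' ν x) i q.2 else 0)| ≤ (n : ℝ) * ρ := by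
    intro ν
    rw [Finset.sum_eq_single (q.1 - unitVec (fine n M) ν) (fun x _ hx => by
      have hne : ¬ q.1 = x + unitVec (fine n M) ν := fun h => hx (by rw [h, add_sub_cancel_right])
      simp [hne]) (fun h => (h (Finset.mem_univ _)).elim)]
    simp only [sub_add_cancel, if_true, ← Finset.mul_sum]
    exact mul_le_mul_of_nonneg_left (by simpa only [Matrix.sub_apply] using hρ ν _ q.2) hn
  calc ∑ x : Tor (fine n M), ∑ ν : Fin (d + 1), ∑ i : ι, (n : ℝ) * |(if q.1 = x + unitVec (fine n M) ν then (T ν x - T' ν x) i q.2 else 0)|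
      = ∑ ν : Fin (d + 1), ∑ x : Tor (fine n M), ∑ i : ι, (n : ℝ) * |(if q.1 = x + unitVec (fine n M) ν then (T ν x - T' ν x) i q.2 else 0)| := Finset.sum_comm
    _ ≤ ∑ _ν : Fin (d + 1), (n : ℝ) * ρ := Finset.sum_le_sum fun ν _ => hν ν
    _ = (n : ℝ) * (Fintype.card (Fin (d + 1)) * ρ) := by rw [Finset.sum_const, Finset.card_univ, nsmul_eq_mul]; ring

/-- THE DIFFERENCE OF TWO COVARIANT BLOCK AVERAGINGS: the same block sum with the difference of the staircase transports. [folklore] -/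
theorem csavg_sub_apply (T T' : Fin (d + 1) → Tor (fine n M) → Matrix ι ι ℝ) (q : Tor M × ι) (p : Tor (fine n M) × ι) :
    (csavg M n T - csavg M n T') q p = if blockOf n M p.1 = q.1 then ((n : ℝ) ^ (d + 1))⁻¹ *
      (cvaStair M n (fun μ b => T μ b.1) q.1 (blockCoords n M p.1).2 0 - cvaStair M n (fun μ b => T' μ b.1) q.1 (blockCoords n M p.1).2 0) q.2 p.2 else 0 := by
  rw [Matrix.sub_apply]
  simp only [csavg, Matrix.sub_apply]
  split_ifs <;> ring

/-- ROW SUMS of `Q′_T − Q′_{T′}`: `≤ σ` when every row of every staircase-transport difference is `≤ σ` (the `n^{d+1}` points of the block against the weight `n^{−(d+1)}`). [folklore] -/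
theorem csavg_sub_rows_le {T T' : Fin (d + 1) → Tor (fine n M) → Matrix ι ι ℝ} {σ : ℝ}
    (hσ : ∀ y a i, ∑ j, |(cvaStair M n (fun μ b => T μ b.1) y a 0 - cvaStair M n (fun μ b => T' μ b.1) y a 0) i j| ≤ σ) (q : Tor M × ι) :
    ∑ p, |(csavg M n T - csavg M n T') q p| ≤ σ := by
  have hn : (0 : ℝ) < (n : ℝ) ^ (d + 1) := pow_pos (Nat.cast_pos.mpr (Nat.pos_of_ne_zero (NeZero.ne n))) _
  rw [Fintype.sum_prod_type, ← (Equiv.ofBijective _ (B5Blocks16.bpt_bijective n M)).sum_comp, Fintype.sum_prod_type]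
  simp only [Equiv.ofBijective_apply, csavg_sub_apply, kingBlockOf_bpt, blockCoords_bpt]
  rw [Finset.sum_eq_single q.1 (fun y _ hy => by simp [hy]) (fun h => (h (Finset.mem_univ _)).elim)]
  simp only [if_true, abs_mul, abs_inv, abs_pow, Nat.abs_cast, ← Finset.mul_sum]
  calc ((n : ℝ) ^ (d + 1))⁻¹ * ∑ a : Fin (d + 1) → Fin n, ∑ j, |(cvaStair M n (fun μ b => T μ b.1) q.1 a 0 - cvaStair M n (fun μ b => T' μ b.1) q.1 a 0) q.2 j|
      ≤ ((n : ℝ) ^ (d + 1))⁻¹ * ∑ _a : Fin (d + 1) → Fin n, σ := mul_le_mul_of_nonneg_left (Finset.sum_le_sum fun a _ => hσ q.1 a q.2) (inv_nonneg.mpr hn.le)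
    _ = σ := by
        rw [Finset.sum_const, Finset.card_univ, nsmul_eq_mul, Fintype.card_pi, Finset.prod_const, Fintype.card_fin, Finset.card_univ, Fintype.card_fin]
        push_cast
        rw [inv_mul_cancel_left₀ hn.ne']

/-- COLUMN SUMS of `Q′_T − Q′_{T′}`: `≤ n^{−(d+1)}·σ` when every column of every staircase-transport difference is `≤ σ` (a fine site lies in one block). [folklore] -/
theorem csavg_sub_cols_le {T T' : Fin (d + 1) → Tor (fine n M) → Matrix ι ι ℝ} {σ : ℝ}
    (hσ : ∀ y a j, ∑ i, |(cvaStair M n (fun μ b => T μ b.1) y a 0 - cvaStair M n (fun μ b => T' μ b.1) y a 0) i j| ≤ σ) (p : Tor (fine n M) × ι) :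
    ∑ q, |(csavg M n T - csavg M n T') q p| ≤ ((n : ℝ) ^ (d + 1))⁻¹ * σ := by
  have hn : (0 : ℝ) < (n : ℝ) ^ (d + 1) := pow_pos (Nat.cast_pos.mpr (Nat.pos_of_ne_zero (NeZero.ne n))) _
  rw [Fintype.sum_prod_type]
  simp only [csavg_sub_apply]
  rw [Finset.sum_eq_single (blockOf n M p.1) (fun y _ hy => by simp [Ne.symm hy]) (fun h => (h (Finset.mem_univ _)).elim)]
  simp only [if_true, abs_mul, abs_inv, abs_pow, Nat.abs_cast, ← Finset.mul_sum]
  exact mul_le_mul_of_nonneg_left (hσ _ _ p.2) (inv_nonneg.mpr hn.le)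

end First

/-! ## §2 Telescoping and resolvent identities -/

section Resolvent

omit M n [∀ μ, NeZero (M μ)] [NeZero n] [DecidableEq ι] [Fintype ι] in
/-- Three-factor telescoping for (rectangular) matrices: `ABC − A′B′C′ = (A−A′)BC + A′(B−B′)C + A′B′(C−C′)`. [folklore] -/
theorem mmul3_sub {l m p q : Type} [Fintype m] [Fintype p] (A A' : Matrix l m ℝ) (B B' : Matrix m p ℝ) (C C' : Matrix p q ℝ) :
    A * B * C - A' * B' * C' = (A - A') * B * C + A' * (B - B') * C + A' * B' * (C - C') := by
  simp only [Matrix.sub_mul, Matrix.mul_sub]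
  abel

omit M n [∀ μ, NeZero (M μ)] [NeZero n] [DecidableEq ι] [Fintype ι] in
/-- Five-factor telescoping for (rectangular) matrices. [folklore] -/
theorem mmul5_sub {l m p q r s : Type} [Fintype m] [Fintype p] [Fintype q] [Fintype r] (A A' : Matrix l m ℝ) (B B' : Matrix m p ℝ) (C C' : Matrix p q ℝ)
    (F F' : Matrix q r ℝ) (G G' : Matrix r s ℝ) :
    A * B * C * F * G - A' * B' * C' * F' * G' =
      (A - A') * B * C * F * G + A' * (B - B') * C * F * G + A' * B' * (C - C') * F * G + A' * B' * C' * (F - F') * G + A' * B' * C' * F' * (G - G') := by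
  simp only [Matrix.sub_mul, Matrix.mul_sub]
  abel

/-- ★ `Δ′_a(T) − Δ′_a(T′) = (D_T − D_{T′})ᵀD_T + D_{T′}ᵀ(D_T − D_{T′}) + a·((Q_T − Q_{T′})ᵀQ_T + Q_{T′}ᵀ(Q_T − Q_{T′}))`. [folklore] -/
theorem claplA_sub (T T' : Fin (d + 1) → Tor (fine n M) → Matrix ι ι ℝ) (a : ℝ) :
    claplA M n T a - claplA M n T' a =
      (cgrad M n T - cgrad M n T')ᵀ * cgrad M n T + (cgrad M n T')ᵀ * (cgrad M n T - cgrad M n T') +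
        a • ((csavg M n T - csavg M n T')ᵀ * csavg M n T + (csavg M n T')ᵀ * (csavg M n T - csavg M n T')) := by
  rw [claplA, claplA]
  simp only [Matrix.transpose_sub, Matrix.sub_mul, Matrix.mul_sub, smul_sub, smul_add]
  abel

/-- ★ **THE RESOLVENT IDENTITY** `G′(T) − G′(T′) = G′(T)·(Δ′_a(T′) − Δ′_a(T))·G′(T′)` (both genuine inverses: `a > 0`, invertible transporters). [cite: Balaban1985BackgroundPropagators, Thm 3.4 p.400 («small perturbations of the operators depending on U only»: mechanism)] -/
theorem cGreen_sub {T T' : Fin (d + 1) → Tor (fine n M) → Matrix ι ι ℝ} (hT : ∀ ν x, IsUnit (T ν x)) (hT' : ∀ ν x, IsUnit (T' ν x)) {a : ℝ} (ha : 0 < a) :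
    cGreen M n T a - cGreen M n T' a = cGreen M n T a * (claplA M n T' a - claplA M n T a) * cGreen M n T' a := by
  rw [Matrix.mul_sub, Matrix.sub_mul, Matrix.mul_assoc, claplA_mul_cGreen M n hT' ha, Matrix.mul_one, cGreen_mul_claplA M n hT ha, Matrix.one_mul]

/-- `G′(T)² − G′(T′)² = (G′(T) − G′(T′))G′(T) + G′(T′)(G′(T) − G′(T′))`. [folklore] -/
theorem cGreen_sq_sub (T T' : Fin (d + 1) → Tor (fine n M) → Matrix ι ι ℝ) (a : ℝ) :
    cGreen M n T a * cGreen M n T a - cGreen M n T' a * cGreen M n T' a =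
      (cGreen M n T a - cGreen M n T' a) * cGreen M n T a + cGreen M n T' a * (cGreen M n T a - cGreen M n T' a) := by
  simp only [Matrix.sub_mul, Matrix.mul_sub]
  abel

/-- ★ `S(T) − S(T′)` for `S = Q′G′²Q′ᵀ`: three one-difference terms. [folklore] -/
theorem cSop_sub (T T' : Fin (d + 1) → Tor (fine n M) → Matrix ι ι ℝ) (a : ℝ) :
    cSop M n T a - cSop M n T' a =
      (csavg M n T - csavg M n T') * (cGreen M n T a * cGreen M n T a) * (csavg M n T)ᵀ +
        csavg M n T' * (cGreen M n T a * cGreen M n T a - cGreen M n T' a * cGreen M n T' a) * (csavg M n T)ᵀ +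
        csavg M n T' * (cGreen M n T' a * cGreen M n T' a) * (csavg M n T - csavg M n T')ᵀ := by
  rw [cSop, cSop, Matrix.transpose_sub]
  exact mmul3_sub _ _ _ _ _ _

/-- ★ **THE RESOLVENT IDENTITY FOR `(Q′G′²Q′ᵀ)⁻¹`**: `S(T)⁻¹ − S(T′)⁻¹ = S(T)⁻¹·(S(T′) − S(T))·S(T′)⁻¹`. [folklore] -/
theorem cSop_inv_sub {T T' : Fin (d + 1) → Tor (fine n M) → Matrix ι ι ℝ} (hT : ∀ ν x, IsUnit (T ν x)) (hT' : ∀ ν x, IsUnit (T' ν x)) {a : ℝ} (ha : 0 < a) :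
    (cSop M n T a)⁻¹ - (cSop M n T' a)⁻¹ = (cSop M n T a)⁻¹ * (cSop M n T' a - cSop M n T a) * (cSop M n T' a)⁻¹ := by
  have h1 : (cSop M n T a)⁻¹ * cSop M n T a = 1 := Matrix.nonsing_inv_mul _ ((Matrix.isUnit_iff_isUnit_det _).mp (isUnit_cSop M n hT ha))
  have h2 : cSop M n T' a * (cSop M n T' a)⁻¹ = 1 := Matrix.mul_nonsing_inv _ ((Matrix.isUnit_iff_isUnit_det _).mp (isUnit_cSop M n hT' ha))
  rw [Matrix.mul_sub, Matrix.sub_mul, Matrix.mul_assoc, h2, Matrix.mul_one, h1, Matrix.one_mul]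

/-- ★★ `Π(T) − Π(T′)` for `Π = G′Q′ᵀS⁻¹Q′G′`: FIVE terms, each with exactly one difference factor. [folklore] -/
theorem cPi_sub (T T' : Fin (d + 1) → Tor (fine n M) → Matrix ι ι ℝ) (a : ℝ) :
    cPi M n T a - cPi M n T' a =
      (cGreen M n T a - cGreen M n T' a) * (csavg M n T)ᵀ * (cSop M n T a)⁻¹ * csavg M n T * cGreen M n T a +
        cGreen M n T' a * (csavg M n T - csavg M n T')ᵀ * (cSop M n T a)⁻¹ * csavg M n T * cGreen M n T a +
        cGreen M n T' a * (csavg M n T')ᵀ * ((cSop M n T a)⁻¹ - (cSop M n T' a)⁻¹) * csavg M n T * cGreen M n T a +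
        cGreen M n T' a * (csavg M n T')ᵀ * (cSop M n T' a)⁻¹ * (csavg M n T - csavg M n T') * cGreen M n T a +
        cGreen M n T' a * (csavg M n T')ᵀ * (cSop M n T' a)⁻¹ * csavg M n T' * (cGreen M n T a - cGreen M n T' a) := by
  rw [cPi, cPi, Matrix.transpose_sub]
  exact mmul5_sub _ _ _ _ _ _ _ _ _ _

/-- ★★ **THE LANDAU SUMMAND AT TWO BACKGROUNDS**: `D(I−R)Dᵀ(T) − D(I−R)Dᵀ(T′) = (D_T − D_{T′})·Π_T·D_Tᵀ + D_{T′}·(Π_T − Π_{T′})·D_Tᵀ + D_{T′}·Π_{T′}·(D_T − D_{T′})ᵀ`.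
[cite: Balaban1985BackgroundPropagators, Thm 3.4 p.400 (mechanism)] -/
theorem landauCov_sub (T T' : Fin (d + 1) → Tor (fine n M) → Matrix ι ι ℝ) (a : ℝ) :
    landauCov M n T a - landauCov M n T' a =
      (cgrad M n T - cgrad M n T') * cPi M n T a * (cgrad M n T)ᵀ + cgrad M n T' * (cPi M n T a - cPi M n T' a) * (cgrad M n T)ᵀ +
        cgrad M n T' * cPi M n T' a * (cgrad M n T - cgrad M n T')ᵀ := by
  rw [landauCov, landauCov, Matrix.transpose_sub]
  exact mmul3_sub _ _ _ _ _ _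

end Resolvent

/-! ## §3 At the flat background: the matrix of the Landau perturbation letter -/

section AtOne

/-- `Π(T) − Π(1) ⊗ₖ 1_ι` in five one-difference terms (the middle factor of `N_V^R`). [folklore] -/
theorem cPi_sub_one (T : Fin (d + 1) → Tor (fine n M) → Matrix ι ι ℝ) (a : ℝ) :
    cPi M n T a - piFlat M n a ⊗ₖ (1 : Matrix ι ι ℝ) =
      (cGreen M n T a - greenFlat M n a ⊗ₖ (1 : Matrix ι ι ℝ)) * (csavg M n T)ᵀ * (cSop M n T a)⁻¹ * csavg M n T * cGreen M n T a +
        greenFlat M n a ⊗ₖ (1 : Matrix ι ι ℝ) * (csavg M n T - qsFlat M n ⊗ₖ (1 : Matrix ι ι ℝ))ᵀ * (cSop M n T a)⁻¹ * csavg M n T * cGreen M n T a +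
        greenFlat M n a ⊗ₖ (1 : Matrix ι ι ℝ) * (qsFlat M n ⊗ₖ (1 : Matrix ι ι ℝ))ᵀ * ((cSop M n T a)⁻¹ - (sopFlat M n a ⊗ₖ (1 : Matrix ι ι ℝ))⁻¹) * csavg M n T * cGreen M n T a +
        greenFlat M n a ⊗ₖ (1 : Matrix ι ι ℝ) * (qsFlat M n ⊗ₖ (1 : Matrix ι ι ℝ))ᵀ * (sopFlat M n a ⊗ₖ (1 : Matrix ι ι ℝ))⁻¹ * (csavg M n T - qsFlat M n ⊗ₖ (1 : Matrix ι ι ℝ)) * cGreen M n T a +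
        greenFlat M n a ⊗ₖ (1 : Matrix ι ι ℝ) * (qsFlat M n ⊗ₖ (1 : Matrix ι ι ℝ))ᵀ * (sopFlat M n a ⊗ₖ (1 : Matrix ι ι ℝ))⁻¹ * (qsFlat M n ⊗ₖ (1 : Matrix ι ι ℝ)) *
          (cGreen M n T a - greenFlat M n a ⊗ₖ (1 : Matrix ι ι ℝ)) := by
  rw [← cPi_one, ← cGreen_one, ← csavg_one, ← cSop_one]
  exact cPi_sub M n T _ a

/-- ★★ **THE MATRIX OF THE LANDAU PERTURBATION LETTER `N_V^R`**: `landauCov T a − landauFlat a ⊗ₖ 1_ι = (D_T − ∂⊗1)·Π_T·D_Tᵀ + (∂⊗1)·(Π_T − Π₁⊗1)·D_Tᵀ + (∂⊗1)(Π₁⊗1)·(D_T − ∂⊗1)ᵀ` —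
every term carries one difference of a first-order object (`D_T − ∂⊗1` has entries `n·(T − 1)` on the shift part; `Π_T − Π₁⊗1` by `cPi_sub_one`). [cite: Balaban1985BackgroundPropagators, (3.49) p.399 and Thm 3.4 p.400 (mechanism)] -/
theorem landauCov_sub_one (T : Fin (d + 1) → Tor (fine n M) → Matrix ι ι ℝ) (a : ℝ) :
    landauCov M n T a - landauFlat M n a ⊗ₖ (1 : Matrix ι ι ℝ) =
      (cgrad M n T - gradFlat M n ⊗ₖ (1 : Matrix ι ι ℝ)) * cPi M n T a * (cgrad M n T)ᵀ +
        gradFlat M n ⊗ₖ (1 : Matrix ι ι ℝ) * (cPi M n T a - piFlat M n a ⊗ₖ (1 : Matrix ι ι ℝ)) * (cgrad M n T)ᵀ +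
        gradFlat M n ⊗ₖ (1 : Matrix ι ι ℝ) * (piFlat M n a ⊗ₖ (1 : Matrix ι ι ℝ)) * (cgrad M n T - gradFlat M n ⊗ₖ (1 : Matrix ι ι ℝ))ᵀ := by
  rw [← landauCov_one, ← cgrad_one, ← cPi_one]
  exact landauCov_sub M n T _ a

end AtOne

end Summit.QuantumFields.YangMills.BalabanUVNodes.N15.CovLandau

end
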